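import Literature.AnabelianGeometry.EtaleTheta.Discharge.Sec1Thm110iUniqueAnchored
import Literature.AnabelianGeometry.EtaleTheta.Discharge.Sec1EvalAtNaturality
import HarnessLib

/-!
# [EtTh] Thm. 1.10 (i), uniqueness clause at anchored standard data — the LAST value-level binder removed:
# `Thm110iUnique` from Prop. 1.5 (ii), (iii) and «`τ⁻¹` is the deck-translate of `τ`» (K2 row r8″, file 3)

S. Mochizuki, *The étale theta function …*, Publ. RIMS 45 (2009), §1: Def. 1.9 p.255 («`√−1` determines a
4-torsion point `τ` …; the 4-torsion point `τ⁻¹` determined by `−√−1`»), Prop. 1.5 (iii) p.249, Thm. 1.10 (i)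
p.255; the `μ₂`-covering `Ÿ → Y` (`Ü² = U`, p.242: `Gal(Ÿ/Y) = Π^tp_Y/Π^tp_Ÿ` acts by `Ü ↦ −Ü`, so the point
of coordinate `−√−1 = (√−1)⁻¹` is the image of `τ` under the nontrivial deck transformation)
[cite: MochizukiEtTh2009, Thm 1.10 (i) p.29].  PROOF-ONLY companion (no `def`) of
`Discharge/Sec1Thm110iUniqueAnchored.lean` (p422549, this seat), abc-iut-L2-t1's `ThetaCohomologyAnchored.lean`
(p421374) and abc-iut-L2-d1's `Discharge/Sec1EvalAtNaturality.lean` (p420910).  Cell sub-DAG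
plan/L2/SUBDAG-EtTh-Thm110.md (K2), holder abc-iut-w5-d140.

In `thm110iUnique_anchored_of_prop15iii` (p422549) the only hypothesis beyond the two FACTS Prop. 1.5 (ii),
(iii) was the SIGN RELATION `value_{τ⁻¹}(η̈) = ± value_τ(η̈)`, there obtained from the two-point value law of
the theta function (`exists_sign_relation_of_valueLaw_pair`).  THIS FILE derives it WITHOUT any value law,
from the group-theoretic rendering of «`τ⁻¹` determined by `−√−1`»: the decomposition group of `τ⁻¹` is the
conjugate of that of `τ` by an element `ε ∈ Π^tp_Y` (a lift of the deck transformation `Ü ↦ −Ü`; any `ε` of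
`toZ`-degree `0` is allowed):
* `ThetaSetting.AnchoredPoint.evalAt_res_eq_of_Dpt_eq` — an ANCHORED point's evaluation is determined by its
  decomposition group: any `NonCuspidalPoint` with the same `D_y` evaluates every class identically
  (`H¹(D_y, Δ_Θ) = {κ(c)|_{D_y}}` by anchoring; cf. abc-iut-w5-d115's `ext_of_Dpt_eq` for two anchored points);
* `MuTwoSetting.exists_sign_relation_of_deck` — with abc-iut-L2-d1's naturally-evaluating conjugate point
  (`exists_translatePoints_of_prop15ii`, from Prop. 1.5 (ii)) sitting on `D_{τ⁻¹}`, and the degree-`0` orbit law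
  `ε·η̈ = η̈·κ(±1)` (`exists_sign_conj_eq_of_toZ_eq_one`, from Prop. 1.5 (ii)(iii)):
  `value_{τ⁻¹}(η̈) = (±1)·value_τ(η̈)`;
* **`MuTwoSetting.thm110iUnique_anchored_of_deck`** — `Thm110iUnique hC hZ E A.toStandardData` from
  {FACT `Prop15ii` (F-2503), FACT `Prop15iii` (F-0591), the anchored Def. 1.9 data `A`, and the deck relation
  `∃ ε, toZ ε = 0 ∧ D_{τ⁻¹} = ε⁻¹ D_τ ε`} — NO statement about values of the theta function remains.
HONEST FRAMING: typed ≠ proved for [EtTh]; facts BY NAME; the deck relation is a hypothesis on the two given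
points (a candidate field of `AnchoredStandardData`); nothing here bears on the disputed [IUTchIII] Cor. 3.12.
-/

noncomputable section

namespace Literature.AnabelianGeometry.EtaleTheta

open Literature.AnabelianGeometry.SemiGraphs

variable {p : ℕ} [Fact p.Prime]

namespace ThetaSetting

namespace AnchoredPoint

variable {D : ThetaSetting p} {E : D.KummerData}

/-- **An anchored point's evaluation is determined by its decomposition group**: if a (not necessarily
anchored) point `y'` has `D_{y'} = D_y` for an ANCHORED `y`, then `y'` evaluates every class of
`H¹(Π^tp_Ÿ, Δ_Θ)` exactly as `y` does — every class on `D_y` is the restriction of a constant's Kummer class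
(anchoring: `evalAt_y` injective), on which both evaluations are pinned by `evalAt_kum`.
[cite: MochizukiEtTh2009, Prop 1.4 (iii) p.22] -/
theorem evalAt_res_eq_of_Dpt_eq (y : AnchoredPoint E) (y' : NonCuspidalPoint E) (h : y'.Dpt = y.Dpt)
    (x : D.H1 D.GtpYdd) :
    y'.evalAt (ContH1.res D.toTheta D.DeltaTheta y'.Dpt_le x) =
      y.evalAt (ContH1.res D.toTheta D.DeltaTheta y.Dpt_le x) := by
  obtain ⟨⟨Dpt, Dpt_le, hinj, hmap, coord, hne, ev, hev⟩, hinj1, hlog1⟩ := y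
  obtain ⟨Dpt', Dpt_le', hinj', hmap', coord', hne', ev', hev'⟩ := y'
  dsimp only at h
  subst h
  dsimp only at hinj1 hev hev' ⊢
  set z := ContH1.res D.toTheta D.DeltaTheta Dpt_le x with hz
  have hz' : z = ContH1.res D.toTheta D.DeltaTheta Dpt_le (D.inflTheta D.GtpYdd (E.kumYdd (ev z))) :=
    hinj1 (by rw [hev])
  calc ev' z = ev' (ContH1.res D.toTheta D.DeltaTheta Dpt_le
        (D.inflTheta D.GtpYdd (E.kumYdd (ev z)))) := by rw [← hz']
    _ = ev z := hev' (ev z)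

end AnchoredPoint

end ThetaSetting

namespace MuTwoSetting

variable {M : MuTwoSetting p}

/-- **The sign relation from the deck transformation** (no value law): if `D_{τ⁻¹} = ε⁻¹ D_τ ε` for some
`ε ∈ Π^tp_X` of `toZ`-degree `0` (a lift of `Gal(Ÿ/Y) ∋ (Ü ↦ −Ü)`, which carries `τ` to `τ⁻¹`), then
`value_{τ⁻¹}(η̈) = w · value_τ(η̈)` with `w = ±1`.  Proof: abc-iut-L2-d1's conjugate point `τ'` on `ε⁻¹ D_τ ε`
evaluates NATURALLY (`value_{τ'}(x) = value_τ(ε·x)`, from Prop. 1.5 (ii)); `τ'` and the anchored `τ⁻¹` share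
`D`, hence evaluate identically (`evalAt_res_eq_of_Dpt_eq`); and `ε·η̈ = η̈·κ(u)`, `u = ±1`, by the degree-`0`
orbit law (Prop. 1.5 (ii)(iii)). [cite: MochizukiEtTh2009, Def 1.9 p.29] -/
theorem exists_sign_relation_of_deck (hC : M.toThetaSetting.Compat)
    {E : M.toThetaSetting.EtaleThetaData} (h15ii : ThetaSetting.Prop15ii E.toKummerData hC)
    (h15iii : ThetaSetting.Prop15iii E hC) (A : M.AnchoredStandardData E.toKummerData)
    (hdeck : ∃ ε : M.PiTemp, M.toZ ε = 1 ∧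
      A.tauInv.Dpt = A.tau.Dpt.comap (MulAut.conj ε).toMonoidHom) :
    ∃ w : (↥M.Kdd)ˣ, (((w : M.Kdd) : PadicAlgCl p) = 1 ∨ ((w : M.Kdd) : PadicAlgCl p) = -1) ∧
      A.tauInv.evalAt (ContH1.res M.toTheta M.toThetaSetting.DeltaTheta A.tauInv.Dpt_le E.etaDd) =
        E.toKddHat w *
          A.tau.evalAt (ContH1.res M.toTheta M.toThetaSetting.DeltaTheta A.tau.Dpt_le E.etaDd) := by
  haveI := hC.GtpYdd_normal
  obtain ⟨ε, hε, hD⟩ := hdeck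
  -- d1's conjugate point on `ε⁻¹ D_τ ε`, with natural evaluation (coordinate prescribed := Ü(τ), unused)
  obtain ⟨τ_, hDpt, -, hnat⟩ := M.exists_translatePoints_of_prop15ii hC h15ii A.tau.toNonCuspidalPoint ε
    (fun _ => A.tau.coord) (fun _ b => A.tau.coord_ne_cusp b)
  have hD1 : (τ_ 1).Dpt = A.tauInv.Dpt := by rw [hDpt 1, zpow_one, ← hD]
  -- the degree-0 orbit law: `ε·η̈ = η̈·κ(u)`, `u = ±1`
  obtain ⟨u, -, hpm, hconj⟩ :=
    exists_sign_conj_eq_of_toZ_eq_one hC h15ii h15iii E.etaDd_mem_thetaClasses hε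
  refine ⟨u, hpm, ?_⟩
  have h1 := hnat 1 E.etaDd
  rw [zpow_one, hconj, map_mul, map_mul, A.tau.evalAt_kum,
    ThetaSetting.AnchoredPoint.evalAt_res_eq_of_Dpt_eq A.tauInv (τ_ 1) hD1] at h1
  rw [← h1, mul_comm]

/-- **[EtTh] Thm. 1.10 (i) «up to ±1» at anchored standard data, from Prop. 1.5 (ii), (iii) and the deck
relation between `τ⁻¹` and `τ` — NO value-level statement about the theta function.**  Hypotheses: the
FACTS `Prop15ii` (F-2503), `Prop15iii` (F-0591); anchored Def. 1.9 data `A` (abc-iut-L2-t1's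
`AnchoredStandardData`); `∃ ε, toZ ε = 0 ∧ D_{τ⁻¹} = ε⁻¹ D_τ ε` («`τ⁻¹` determined by `−√−1`», the image of `τ`
under the `μ₂`-deck transformation of `Ÿ → Y`). [cite: MochizukiEtTh2009, Thm 1.10 (i) p.29] -/
theorem thm110iUnique_anchored_of_deck (hC : M.toThetaSetting.Compat) {εZ : M.GtpC}
    (hZ : M.IsAdmissibleEpsZ εZ) (E : M.toThetaSetting.EtaleThetaData)
    (A : M.AnchoredStandardData E.toKummerData)
    (h15ii : ThetaSetting.Prop15ii E.toKummerData hC) (h15iii : ThetaSetting.Prop15iii E hC)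
    (hdeck : ∃ ε : M.PiTemp, M.toZ ε = 1 ∧
      A.tauInv.Dpt = A.tau.Dpt.comap (MulAut.conj ε).toMonoidHom) :
    Thm110iUnique hC hZ E A.toStandardData :=
  thm110iUnique_anchored_of_prop15iii hC hZ E A h15ii h15iii
    (exists_sign_relation_of_deck hC h15ii h15iii A hdeck)

/-! ## Addendum (v2): evaluation naturality at an ANCHORED conjugate point — no constructed point in
the statement (GAP row G-L2t6g4-1 «evalAt naturality» in closed form) -/

/-- **Evaluation naturality for anchored targets.**  If an ANCHORED point `y'` sits on the conjugate
decomposition group `σ⁻¹ D_y σ` of an arbitrary point `y` (`σ ∈ Π^tp_X`, any `toZ`-degree), then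
`value_{y'}(x) = value_y(σ·x)` for EVERY class `x ∈ H¹(Π^tp_Ÿ, Δ_Θ)`.  Proof: abc-iut-L2-d1's conjugate point
on `σ⁻¹ D_y σ` evaluates naturally by construction (`exists_translatePoints_of_prop15ii`, Prop. 1.5 (ii):
`Π^tp_X` fixes the constant classes), and shares `D` with the anchored `y'`, hence evaluates identically
(`AnchoredPoint.evalAt_res_eq_of_Dpt_eq`).  With `σ := σ₁^a` this is the value at the `a`-th translate;
with `σ := ε` of degree `0` it is the deck relation used above. [cite: MochizukiEtTh2009, Prop 1.4 (iii) p.22] -/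
theorem evalAt_res_eq_of_Dpt_eq_comap (hC : M.toThetaSetting.Compat)
    {E : M.toThetaSetting.KummerData} (h15ii : ThetaSetting.Prop15ii E hC)
    (y : ThetaSetting.NonCuspidalPoint E) (y' : ThetaSetting.AnchoredPoint E) (σ : M.PiTemp)
    (h : y'.Dpt = y.Dpt.comap (MulAut.conj σ).toMonoidHom)
    (x : M.toThetaSetting.H1 M.toThetaSetting.GtpYdd) :
    haveI := hC.GtpYdd_normal
    y'.evalAt (ContH1.res M.toTheta M.toThetaSetting.DeltaTheta y'.Dpt_le x) =
      y.evalAt (ContH1.res M.toTheta M.toThetaSetting.DeltaTheta y.Dpt_le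
        (ContH1.conj M.toTheta M.toThetaSetting.DeltaTheta σ x)) := by
  haveI := hC.GtpYdd_normal
  obtain ⟨τ_, hDpt, -, hnat⟩ := M.exists_translatePoints_of_prop15ii hC h15ii y σ
    (fun _ => y.coord) (fun _ b => y.coord_ne_cusp b)
  have hD1 : (τ_ 1).Dpt = y'.Dpt := by rw [hDpt 1, zpow_one, ← h]
  rw [← ThetaSetting.AnchoredPoint.evalAt_res_eq_of_Dpt_eq y' (τ_ 1) hD1 x, ← hnat 1 x, zpow_one]

/-- **The deck relation transports EVERY value, not only that of `η̈`**: under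
`D_{τ⁻¹} = ε⁻¹ D_τ ε`, `value_{τ⁻¹}(x) = value_τ(ε·x)` for all classes `x` (so a value law at `τ`
along the conjugated translates gives the value law at `τ⁻¹`). [cite: MochizukiEtTh2009, Def 1.9 p.29] -/
theorem AnchoredStandardData.evalAt_tauInv_eq_of_deck (hC : M.toThetaSetting.Compat)
    {E : M.toThetaSetting.KummerData} (h15ii : ThetaSetting.Prop15ii E hC)
    (A : M.AnchoredStandardData E) {ε : M.PiTemp}
    (hD : A.tauInv.Dpt = A.tau.Dpt.comap (MulAut.conj ε).toMonoidHom)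
    (x : M.toThetaSetting.H1 M.toThetaSetting.GtpYdd) :
    haveI := hC.GtpYdd_normal
    A.tauInv.evalAt (ContH1.res M.toTheta M.toThetaSetting.DeltaTheta A.tauInv.Dpt_le x) =
      A.tau.evalAt (ContH1.res M.toTheta M.toThetaSetting.DeltaTheta A.tau.Dpt_le
        (ContH1.conj M.toTheta M.toThetaSetting.DeltaTheta ε x)) :=
  evalAt_res_eq_of_Dpt_eq_comap hC h15ii A.tau.toNonCuspidalPoint A.tauInv ε hD x

end MuTwoSetting

end Literature.AnabelianGeometry.EtaleTheta

end
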